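import Summits.RiemannHypothesis.RiemannHypothesis.Theorems.Splittings.LiRephasingSchedule
import HarnessLib

/-!
# LI B18 KERNEL Q4/6 — EXISTENCE OF SCALES AND SCHEDULES; THEOREM A∞ `theoremA_infty`, `rephasing_kills_every_floor` (SketchG16B §8) — PURE / RH-FREE

PRE-CUT (not filed).  Lane (xi-q) «LI B18 KERNEL» ×6 = Q1 `LiRephasingGainBudget` → Q2 `LiOneStepRephasing` → Q3 `LiRephasingSchedule` →
Q4 `LiRephasingScales` → Q5 `LiRephasingMovingCutPrelim` → Q6 `LiRephasingMovingCut` RESERVED by RULING #204 (rh-split lead g6,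
2026-08-27T18:03:10Z): GO = (xi-p) `LiRephasingKit` ACCEPTED (p553624, 18:01:43Z) + referee g8 BYTES and negctl replay on the six carved shas;
LOWEST priority; filing words `--supports stmt-RiemannHypothesis-19649 --as helper`, kind auto, parts land in chain order.  Cell rh-split,
seat rh-split-li-bridge (kernel author g16, cutter g17; brief sha16 f79c5f09d8bcb036), card `run/shared/lean/pub/rh-split/cards/SPLIT-li-bridge.md`
§23 / 23.8 (model barrier B18 «INCREMENT-LEVEL RE-PHASING ⟂ COUNTING-LAW BRIDGES»).  Kernel source `HOME/rh-split-li-bridge/SketchG16B.lean`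
sha16 cf2b65fdbda323e2 (1639 l, ns `RhSplit.LiBridgeG16`, farm rc 0 · 0 err · 0 warn · 0 sorry, std axioms; §§1–6 = `SketchG16.lean`
355f955084e6fc2c byte-identical prefix, referee REPLAY PASS 17:02Z / RULING #176; §§7–9 referee REPLAY PASS 17:28:47Z / RULING #186);
cut plan `CARVE-16.md` 677f9696f1bd3382; reconstruction note `HOME/rh-split-li-bridge/carve-16/README.md` (CUT ONLY — no regeneration).
THIS PART = scratch ll.881–1134 (§8)
↦ ll.52–305 here; decl text BYTE-VERBATIM (statements AND proofs, scratch section headers kept).  Deltas = namespace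
`RhSplit.LiBridgeG16` ↦ `Summit.RiemannHypothesis.RiemannHypothesis.Theorems.Splittings.LiRephasingScales`, imports (Q3 `…Splittings.LiRephasingSchedule` + HarnessLib),
this header, `set_option linter.dupNamespace false`, the `open` lines (the scratch's + `…Splittings.LiRephasingKit` + the earlier parts'
namespaces).  The six SketchG15B lemmas of scratch §1 (`exists_sin_eq_neg_one_of_phase_drop`, `four_sin_half_mul_sin`,
`sum_range_phase_telescope`, `abs_sum_range_phase_le`, `abs_sum_range_family_le`, `exists_le_on_block`) are CITED from the tree's
`LiRephasingKit` (lane (xi-p)), never restated.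

Content: §8 the parameter arithmetic: `scaleN_le`, `budget_arith`, `count_le'`, **`exists_scale`** (above ANY floor `T ≥ 260`, for ANY
sparsity `m ≥ 1` and floor constant `K`, a zone `(T, 2^J T]`, `J = 208m + ⌈12C⌉₊ + 2`, and a block start `N` satisfying every
inequality a `Schedule` asks for), `ScaleData`/`scaleData`, `Tseq`, **`mkSchedule`** (+ `_m`, `_dec`, `_T_ge`, `_N_ge`),
**`theoremA_infty`** (THEOREM A∞: one sparse sub-spacing re-phasing of the true ordinates violating the floors `K_k − ½ log n` on every
block of an unbounded schedule) and `rephasing_kills_every_floor`.  1 structure, 3 defs, 10 theorems.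

HONEST LABEL: SPLITTING SEARCH over kernel-typed RH-EQUIVALENCES; a splitting A ∧ B ⟹ RH is CONDITIONAL bookkeeping
unless A and B are both proved; nothing here bears on the truth of RH.  Every theorem below is PURE (trigonometry /
finite sums / calculus / parameter arithmetic) or RH-FREE (about the true zeta zeros, no hypothesis on their real parts);
none is a claim about RH, PL or K7ev; the whole chain is BARRIER-SIDE bookkeeping (B18), not a conjunct toward RH.
-/

set_option linter.dupNamespace false

namespace Summit.RiemannHypothesis.RiemannHypothesis.Theorems.Splittings.LiRephasingScales

open Real Set Finset
open Literature.NumberTheory.LFunctions Literature.NumberTheory.LFunctions.SchoenfeldBound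
open Literature.NumberTheory.LFunctions.AlpogeFurman2026
open Literature.NumberTheory.LFunctions.SoundTest
open Summit.RiemannHypothesis.RiemannHypothesis.Theorems.LiTheory
open Summit.RiemannHypothesis.RiemannHypothesis.Theorems.Splittings
open Summit.RiemannHypothesis.RiemannHypothesis.Theorems.Splittings.LiIncrHighPart
open Summit.RiemannHypothesis.RiemannHypothesis.Theorems.Splittings.LiRephasingKit
open Summit.RiemannHypothesis.RiemannHypothesis.Theorems.Splittings.LiRephasingGainBudget
open Summit.RiemannHypothesis.RiemannHypothesis.Theorems.Splittings.LiOneStepRephasing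
open Summit.RiemannHypothesis.RiemannHypothesis.Theorems.Splittings.LiRephasingSchedule

/-! ## §8 Existence of scales and of schedules (the parameter arithmetic) — PURE / RH-FREE

The inequalities a `Schedule` asks for at one scale are satisfiable above ANY floor `T ≥ 260`, for ANY sparsity `m ≥ 1`
and ANY floor constant `K`: take the zone `(T, 2^J T]` with `J = 208 m + ⌈12 C⌉ + 2`, `C = max(13 m (2 log T − K + 2), 0)`,
the cut `Y = 2^J T` and the block start `N = ⌈32 Y² log Y⌉ + ⌈16πY⌉ + ⌈12 (Y+1) log(Y+3)⌉ + 1` (crude but explicit;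
then `log 2N ≤ 4 log Y`, `4·N(Y)/N ≤ 1` by the tree's `LiLowZeroBudget.count_le`, and the quadratic budget
`(log 2/2)·J(J−1)` beats the linear cost `26 m log 2 · J + C`).  Iterating with `T_{k+1} := Y_k` gives a schedule for
every sparsity sequence `m_k ≥ 1` and floor sequence `K_k`. -/

/-- Crude size bound for the block start. PURE. -/
theorem scaleN_le {Y : ℝ} (hY : 260 ≤ Y) :
    ((⌈32 * Y ^ 2 * Real.log Y⌉₊ + ⌈16 * π * Y⌉₊ + ⌈12 * (Y + 1) * Real.log (Y + 3)⌉₊ + 1 : ℕ) : ℝ) ≤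
      32 * Y ^ 3 := by
  have hY0 : 0 < Y := by linarith
  have hlogY : Real.log Y ≤ Y - 1 := Real.log_le_sub_one_of_pos hY0
  have hlogY0 : 0 ≤ Real.log Y := Real.log_nonneg (by linarith)
  have hlog3 : Real.log (Y + 3) ≤ Y + 2 := by
    linarith [Real.log_le_sub_one_of_pos (show 0 < Y + 3 by linarith)]
  have hlog30 : 0 ≤ Real.log (Y + 3) := Real.log_nonneg (by linarith)
  have hπ := Real.pi_lt_four
  have hπ0 := Real.pi_pos
  have c1 := Nat.ceil_lt_add_one (show 0 ≤ 32 * Y ^ 2 * Real.log Y by positivity)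
  have c2 := Nat.ceil_lt_add_one (show 0 ≤ 16 * π * Y by positivity)
  have c3 := Nat.ceil_lt_add_one (show 0 ≤ 12 * (Y + 1) * Real.log (Y + 3) by positivity)
  have p1 : 32 * Y ^ 2 * Real.log Y ≤ 32 * Y ^ 3 - 32 * Y ^ 2 := by nlinarith [sq_nonneg Y]
  have p2 : 16 * π * Y ≤ 64 * Y := by nlinarith
  have p3 : 12 * (Y + 1) * Real.log (Y + 3) ≤ 12 * Y ^ 2 + 36 * Y + 24 := by nlinarith
  have p4 : 260 * Y ≤ Y ^ 2 := by nlinarith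
  push_cast
  linarith

/-- The quadratic budget beats the linear cost. PURE. -/
theorem budget_arith {m : ℕ} (hm : 0 < m) {L K C : ℝ} (hC0 : 0 ≤ C) (hC1 : 13 * m * (2 * L - K + 2) ≤ C)
    {J : ℕ} (hJ : (208 * m + 12 * C + 2 : ℝ) ≤ J) :
    13 * m * (2 * (J * Real.log 2 + L) - K + 2) ≤ Real.log 2 * (J * (J - 1) / 2) := by
  have ha : 0.6931471803 < Real.log 2 := Real.log_two_gt_d9
  have ha0 : 0 ≤ Real.log 2 := by linarith
  have hm0 : (0 : ℝ) ≤ m := Nat.cast_nonneg m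
  have hJ2 : (2 : ℝ) ≤ J := by nlinarith
  have hJ0 : (0 : ℝ) ≤ J := by linarith
  have h1 : (J : ℝ) * (208 * m + 12 * C + 2) ≤ (J : ℝ) * J := mul_le_mul_of_nonneg_left hJ hJ0
  have h4 : Real.log 2 * ((J : ℝ) * (208 * m + 12 * C + 2)) ≤ Real.log 2 * ((J : ℝ) * J) :=
    mul_le_mul_of_nonneg_left h1 ha0
  have h2 : 1 ≤ Real.log 2 * J := by nlinarith
  have h3 : C ≤ 6 * (Real.log 2 * J) * C := by nlinarith
  have h5 : 0 ≤ Real.log 2 * m * J := by positivity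
  have h6 : 0 ≤ Real.log 2 * J := by positivity
  nlinarith

/-- The count bound in the shape used here: `Σ_{0<γ≤Y} m_ρ ≤ 3 (Y+1) log(Y+3)` (`Y ≥ 0`; tree `count_le`). RH-FREE. -/
theorem count_le' {Y : ℝ} (hY : 0 ≤ Y) :
    ∑ ρ ∈ zerosBetween 0 Y, mult ρ ≤ 3 * (Y + 1) * Real.log (Y + 3) := by
  have h := LiLowZeroBudget.count_le Y
  have hc : (⌈Y⌉₊ : ℝ) < Y + 1 := Nat.ceil_lt_add_one hY
  have hc0 : (0 : ℝ) ≤ ⌈Y⌉₊ := Nat.cast_nonneg _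
  have hlog : Real.log ((⌈Y⌉₊ : ℝ) + 2) ≤ Real.log (Y + 3) := Real.log_le_log (by linarith) (by linarith)
  have hlog0 : 0 ≤ Real.log ((⌈Y⌉₊ : ℝ) + 2) := Real.log_nonneg (by linarith)
  have hlog30 : 0 ≤ Real.log (Y + 3) := Real.log_nonneg (by linarith)
  calc ∑ ρ ∈ zerosBetween 0 Y, mult ρ ≤ 3 * ⌈Y⌉₊ * Real.log ((⌈Y⌉₊ : ℝ) + 2) := h
    _ ≤ 3 * (Y + 1) * Real.log (Y + 3) := by nlinarith

/-- **EXISTENCE OF A SCALE.**  Above any floor `T ≥ 260`, for any sparsity `m ≥ 1` and floor constant `K`, there are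
`J ≥ 2` and `N ≥ 1` satisfying reach, decorrelation and the budget inequality of `floor_violation_log` with cut
`Y = 2^J T`. PURE arithmetic + the tree's count bound. RH-FREE. -/
theorem exists_scale {T : ℝ} (hT : 260 ≤ T) {m : ℕ} (hm : 0 < m) (K : ℝ) :
    ∃ J N : ℕ, 2 ≤ J ∧ 0 < N ∧ 16 * π * (2 ^ J * T) ≤ (N : ℝ) ∧
      32 * (2 ^ J * T) ^ 2 * Real.log (2 ^ J * T) ≤ (N : ℝ) ∧
      13 * m * (Real.log (2 * N) / 2 - K + 1 + 4 * (∑ ρ ∈ zerosBetween 0 (2 ^ J * T), mult ρ) / N) ≤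
        J * Real.log (T / (2 * π)) + Real.log 2 * (J * (J - 1) / 2) := by
  set C : ℝ := max (13 * m * (2 * Real.log T - K + 2)) 0 with hC
  have hC0 : 0 ≤ C := le_max_right _ _
  have hC1 : 13 * m * (2 * Real.log T - K + 2) ≤ C := le_max_left _ _
  set J : ℕ := 208 * m + ⌈12 * C⌉₊ + 2 with hJdef
  have hJreal : (208 * m + 12 * C + 2 : ℝ) ≤ J := by
    have := Nat.le_ceil (12 * C)
    rw [hJdef]; push_cast; linarith
  have hT0 : 0 < T := by linarith
  set Y : ℝ := 2 ^ J * T with hYdef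
  have h2J : (1 : ℝ) ≤ 2 ^ J := one_le_pow₀ (by norm_num)
  have hTY : T ≤ Y := le_mul_of_one_le_left hT0.le h2J
  have hY : 260 ≤ Y := hT.trans hTY
  have hY0 : 0 < Y := by linarith
  set N : ℕ := ⌈32 * Y ^ 2 * Real.log Y⌉₊ + ⌈16 * π * Y⌉₊ + ⌈12 * (Y + 1) * Real.log (Y + 3)⌉₊ + 1 with hNdef
  have hNreal : (N : ℝ) = ⌈32 * Y ^ 2 * Real.log Y⌉₊ + ⌈16 * π * Y⌉₊ + ⌈12 * (Y + 1) * Real.log (Y + 3)⌉₊ + 1 := by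
    rw [hNdef]; push_cast; ring
  have e1 := Nat.le_ceil (32 * Y ^ 2 * Real.log Y)
  have e2 := Nat.le_ceil (16 * π * Y)
  have e3 := Nat.le_ceil (12 * (Y + 1) * Real.log (Y + 3))
  have n1 : (0 : ℝ) ≤ ⌈32 * Y ^ 2 * Real.log Y⌉₊ := Nat.cast_nonneg _
  have n2 : (0 : ℝ) ≤ ⌈16 * π * Y⌉₊ := Nat.cast_nonneg _
  have n3 : (0 : ℝ) ≤ ⌈12 * (Y + 1) * Real.log (Y + 3)⌉₊ := Nat.cast_nonneg _
  have hNpos : 0 < N := by rw [hNdef]; omega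
  have hreach : 16 * π * Y ≤ (N : ℝ) := by rw [hNreal]; linarith
  have hdec : 32 * Y ^ 2 * Real.log Y ≤ (N : ℝ) := by rw [hNreal]; linarith
  have hcnt : 12 * (Y + 1) * Real.log (Y + 3) ≤ (N : ℝ) := by rw [hNreal]; linarith
  refine ⟨J, N, by rw [hJdef]; omega, hNpos, hreach, hdec, ?_⟩
  -- the count term is at most 1
  have hM := count_le' hY0.le
  have hN0 : (0 : ℝ) < N := by exact_mod_cast hNpos
  have hfrac : 4 * (∑ ρ ∈ zerosBetween 0 Y, mult ρ) / N ≤ 1 := by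
    rw [div_le_one hN0]; linarith
  -- `log 2N ≤ 4 log Y`
  have hNle : (N : ℝ) ≤ 32 * Y ^ 3 := by rw [hNdef]; exact scaleN_le hY
  have hlog2N : Real.log (2 * N) ≤ 4 * Real.log Y := by
    have hY4 : 2 * (N : ℝ) ≤ Y ^ 4 := by nlinarith [pow_pos hY0 3]
    calc Real.log (2 * N) ≤ Real.log (Y ^ 4) := Real.log_le_log (by positivity) hY4
      _ = 4 * Real.log Y := by rw [Real.log_pow]; norm_num
  have hlogY : Real.log Y = J * Real.log 2 + Real.log T := by
    rw [hYdef, Real.log_mul (by positivity) hT0.ne', Real.log_pow]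
  -- `log(T/2π) ≥ 0`
  have hlogT : 0 ≤ Real.log (T / (2 * π)) := by
    apply Real.log_nonneg
    rw [le_div_iff₀ (by positivity)]
    linarith [Real.pi_lt_four]
  have hm0 : (0 : ℝ) ≤ 13 * m := by positivity
  have hJ0 : (0 : ℝ) ≤ J := Nat.cast_nonneg J
  have hstep : 13 * m * (Real.log (2 * N) / 2 - K + 1 + 4 * (∑ ρ ∈ zerosBetween 0 Y, mult ρ) / N) ≤
      13 * m * (2 * (J * Real.log 2 + Real.log T) - K + 2) := by
    apply mul_le_mul_of_nonneg_left _ hm0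
    linarith
  have hba := budget_arith hm hC0 hC1 hJreal (L := Real.log T) (K := K)
  nlinarith

/-! ### Building a schedule from the scales -/

/-- The data of one scale, chosen once and for all (from `exists_scale`). -/
structure ScaleData (T : ℝ) (m : ℕ) (K : ℝ) where
  /-- zone exponent -/
  J : ℕ
  /-- block start -/
  N : ℕ
  hJ : 2 ≤ J
  hN : 0 < N
  hreach : 16 * π * (2 ^ J * T) ≤ (N : ℝ)
  hdec : 32 * (2 ^ J * T) ^ 2 * Real.log (2 ^ J * T) ≤ (N : ℝ)
  hbudget : 13 * m * (Real.log (2 * N) / 2 - K + 1 + 4 * (∑ ρ ∈ zerosBetween 0 (2 ^ J * T), mult ρ) / N) ≤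
    J * Real.log (T / (2 * π)) + Real.log 2 * (J * (J - 1) / 2)

/-- A choice of scale data above the floor `T`. -/
noncomputable def scaleData {T : ℝ} (hT : 260 ≤ T) {m : ℕ} (hm : 0 < m) (K : ℝ) : ScaleData T m K :=
  let h := exists_scale hT hm K
  ⟨h.choose, h.choose_spec.choose, h.choose_spec.choose_spec.1, h.choose_spec.choose_spec.2.1,
    h.choose_spec.choose_spec.2.2.1, h.choose_spec.choose_spec.2.2.2.1, h.choose_spec.choose_spec.2.2.2.2⟩

/-- The zone floors: `T_0 = 260`, `T_{k+1} = 2^{J_k} T_k` (= the cut `Y_k`). -/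
noncomputable def Tseq (mseq : ℕ → ℕ) (hm : ∀ k, 0 < mseq k) (Kseq : ℕ → ℝ) : ℕ → {T : ℝ // 260 ≤ T}
  | 0 => ⟨260, le_rfl⟩
  | k + 1 =>
    ⟨2 ^ (scaleData (Tseq mseq hm Kseq k).2 (hm k) (Kseq k)).J * (Tseq mseq hm Kseq k).1,
      (Tseq mseq hm Kseq k).2.trans (le_mul_of_one_le_left (by linarith [(Tseq mseq hm Kseq k).2])
        (one_le_pow₀ (by norm_num)))⟩

/-- **THE SCHEDULE** for sparsities `m_k` and floor constants `K_k` (floors `−A_k`, `A_k = ½ log 2N_k − K_k + 1`). -/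
noncomputable def mkSchedule (mseq : ℕ → ℕ) (hm : ∀ k, 0 < mseq k) (Kseq : ℕ → ℝ) : Schedule where
  N k := (scaleData (Tseq mseq hm Kseq k).2 (hm k) (Kseq k)).N
  T k := (Tseq mseq hm Kseq k).1
  J k := (scaleData (Tseq mseq hm Kseq k).2 (hm k) (Kseq k)).J
  m := mseq
  Y k := 2 ^ (scaleData (Tseq mseq hm Kseq k).2 (hm k) (Kseq k)).J * (Tseq mseq hm Kseq k).1
  A k := Real.log (2 * (scaleData (Tseq mseq hm Kseq k).2 (hm k) (Kseq k)).N) / 2 - Kseq k + 1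
  hT k := (Tseq mseq hm Kseq k).2
  hY _ := le_rfl
  hsep _ := le_of_eq rfl
  hm := hm
  hN k := (scaleData (Tseq mseq hm Kseq k).2 (hm k) (Kseq k)).hN
  hreach k := (scaleData (Tseq mseq hm Kseq k).2 (hm k) (Kseq k)).hreach
  hbudget k := (scaleData (Tseq mseq hm Kseq k).2 (hm k) (Kseq k)).hbudget

/-- The constructed schedule has the prescribed class moduli: `(mkSchedule …).m = mseq`. PURE (by `rfl`). -/
theorem mkSchedule_m (mseq : ℕ → ℕ) (hm : ∀ k, 0 < mseq k) (Kseq : ℕ → ℝ) :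
    (mkSchedule mseq hm Kseq).m = mseq := rfl

/-- The constructed schedule meets the decay-size condition `32 (2^J T)^2 log(2^J T) ≤ N` at every step. PURE. -/
theorem mkSchedule_dec (mseq : ℕ → ℕ) (hm : ∀ k, 0 < mseq k) (Kseq : ℕ → ℝ) (k : ℕ) :
    32 * (2 ^ ((mkSchedule mseq hm Kseq).J k) * (mkSchedule mseq hm Kseq).T k) ^ 2 *
        Real.log (2 ^ ((mkSchedule mseq hm Kseq).J k) * (mkSchedule mseq hm Kseq).T k) ≤
      ((mkSchedule mseq hm Kseq).N k : ℝ) :=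
  (scaleData (Tseq mseq hm Kseq k).2 (hm k) (Kseq k)).hdec

/-- The blocks run off to infinity: `N_k ≥ T_k ≥ 260·4^k`. -/
theorem mkSchedule_T_ge (mseq : ℕ → ℕ) (hm : ∀ k, 0 < mseq k) (Kseq : ℕ → ℝ) (k : ℕ) :
    260 * 4 ^ k ≤ (mkSchedule mseq hm Kseq).T k := by
  induction k with
  | zero => show (260 : ℝ) * 4 ^ 0 ≤ 260; norm_num
  | succ k ih =>
    show 260 * 4 ^ (k + 1) ≤ 2 ^ (scaleData (Tseq mseq hm Kseq k).2 (hm k) (Kseq k)).J * (Tseq mseq hm Kseq k).1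
    have hJ := (scaleData (Tseq mseq hm Kseq k).2 (hm k) (Kseq k)).hJ
    have h4 : (4 : ℝ) ≤ 2 ^ (scaleData (Tseq mseq hm Kseq k).2 (hm k) (Kseq k)).J := by
      calc (4 : ℝ) = 2 ^ 2 := by norm_num
        _ ≤ _ := pow_le_pow_right₀ (by norm_num) hJ
    have hT : 260 * 4 ^ k ≤ (Tseq mseq hm Kseq k).1 := ih
    have hT0 : (0 : ℝ) ≤ 260 * 4 ^ k := by positivity
    calc (260 : ℝ) * 4 ^ (k + 1) = 4 * (260 * 4 ^ k) := by ring
      _ ≤ 2 ^ (scaleData (Tseq mseq hm Kseq k).2 (hm k) (Kseq k)).J * (Tseq mseq hm Kseq k).1 :=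
        mul_le_mul h4 hT hT0 (by positivity)

/-- The constructed schedule's sample sizes grow at least like `260 · 4^k`. PURE. -/
theorem mkSchedule_N_ge (mseq : ℕ → ℕ) (hm : ∀ k, 0 < mseq k) (Kseq : ℕ → ℝ) (k : ℕ) :
    260 * 4 ^ k ≤ ((mkSchedule mseq hm Kseq).N k : ℝ) := by
  have h1 := mkSchedule_T_ge mseq hm Kseq k
  have h2 := (mkSchedule mseq hm Kseq).hreach k
  have hT0 : 0 < (mkSchedule mseq hm Kseq).T k := (mkSchedule mseq hm Kseq).T_pos k
  have h3 : (mkSchedule mseq hm Kseq).T k ≤ 16 * π * (2 ^ ((mkSchedule mseq hm Kseq).J k) * (mkSchedule mseq hm Kseq).T k) := by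
    have := (mkSchedule mseq hm Kseq).T_le_top k
    nlinarith [Real.pi_gt_three]
  linarith

/-- **THEOREM A∞ (KERNEL, RH-FREE).**  For every sparsity sequence `m_k ≥ 1` and floor sequence `K_k` there is a
schedule with these sparsities whose single limiting re-phasing `glim` — identity off the zones, moving inside zone `k`
only every `m_k`-th zero, each by at most `(2π/log γ)/16` and at most `1`, DOWNWARD, counting function within
`3 log(t+2)` of the truth — makes the re-phased low phase sum drop below `K_k − ½ log n` at some index `n` of every
block `[N_k, 2N_k)`, `N_k ≥ 260·4^k`. -/
theorem theoremA_infty (mseq : ℕ → ℕ) (hm : ∀ k, 0 < mseq k) (Kseq : ℕ → ℝ) :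
    ∃ S : Schedule, S.m = mseq ∧ (∀ k, 260 * 4 ^ k ≤ (S.N k : ℝ)) ∧
      (∀ Y t, 0 ≤ t → countRe (fun ρ ↦ ρ.im) Y t ≤ countRe S.glim Y t ∧
        countRe S.glim Y t ≤ countRe (fun ρ ↦ ρ.im) Y t + 3 * Real.log (t + 2)) ∧
      (∀ k ρ, ρ ∈ S.zone k →
        ρ.im - 2 * π / Real.log ρ.im / 16 ≤ S.glim ρ ∧ ρ.im - 1 ≤ S.glim ρ ∧ S.glim ρ ≤ ρ.im) ∧
      (∀ ρ, (∀ k, ρ ∉ S.zone k) → S.glim ρ = ρ.im) ∧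
      (∀ k, ∃ c < mseq k, ∀ ρ ∈ S.zone k, ρ ∉ sel (S.zone k) (mseq k) c → S.glim ρ = ρ.im) ∧
      ∀ k, ∃ n ∈ Finset.Ico (S.N k) (2 * S.N k), lowSumRe S.glim n (S.Y k) < Kseq k - Real.log n / 2 := by
  refine ⟨mkSchedule mseq hm Kseq, rfl, mkSchedule_N_ge mseq hm Kseq,
    fun Y t ht ↦ (mkSchedule mseq hm Kseq).glim_count (mkSchedule_dec mseq hm Kseq) Y ht,
    fun k ρ hρ ↦ (mkSchedule mseq hm Kseq).glim_moved_spacing (mkSchedule_dec mseq hm Kseq) hρ,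
    fun ρ h ↦ (mkSchedule mseq hm Kseq).glim_eq_im h,
    fun k ↦ (mkSchedule mseq hm Kseq).glim_sparse k, fun k ↦ ?_⟩
  obtain ⟨n, hn, hle⟩ := (mkSchedule mseq hm Kseq).chain_violates k
  refine ⟨n, hn, ?_⟩
  obtain ⟨h1, h2⟩ := Finset.mem_Ico.1 hn
  have hNpos := (mkSchedule mseq hm Kseq).hN k
  have hn0 : (0 : ℝ) < n := by exact_mod_cast lt_of_lt_of_le hNpos h1
  have hn2 : (n : ℝ) ≤ 2 * ((mkSchedule mseq hm Kseq).N k : ℝ) := by exact_mod_cast h2.le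
  have hlog : Real.log n ≤ Real.log (2 * ((mkSchedule mseq hm Kseq).N k : ℝ)) := Real.log_le_log hn0 hn2
  have hA : (mkSchedule mseq hm Kseq).A k = Real.log (2 * ((mkSchedule mseq hm Kseq).N k : ℝ)) / 2 - Kseq k + 1 := rfl
  rw [hA] at hle
  linarith

/-- **COROLLARY (B18 in kernel).**  With `K_k = −k`: ONE re-phasing of the true zeta ordinates, invisible to every
counting law of resolution `≥ 3 log(t+2)`, moving a `(1/m_k)`-sparse class of zone `k` by `≤ spacing/16`, violates the
floor `K − ½ log n` for EVERY `K` at indices `n → ∞` (cut = top of the zone of the scale). RH-FREE. -/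
theorem rephasing_kills_every_floor (mseq : ℕ → ℕ) (hm : ∀ k, 0 < mseq k) :
    ∃ S : Schedule, S.m = mseq ∧ (∀ k, 260 * 4 ^ k ≤ (S.N k : ℝ)) ∧
      (∀ Y t, 0 ≤ t → countRe (fun ρ ↦ ρ.im) Y t ≤ countRe S.glim Y t ∧
        countRe S.glim Y t ≤ countRe (fun ρ ↦ ρ.im) Y t + 3 * Real.log (t + 2)) ∧
      (∀ k ρ, ρ ∈ S.zone k →
        ρ.im - 2 * π / Real.log ρ.im / 16 ≤ S.glim ρ ∧ ρ.im - 1 ≤ S.glim ρ ∧ S.glim ρ ≤ ρ.im) ∧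
      (∀ ρ, (∀ k, ρ ∉ S.zone k) → S.glim ρ = ρ.im) ∧
      (∀ k, ∃ c < mseq k, ∀ ρ ∈ S.zone k, ρ ∉ sel (S.zone k) (mseq k) c → S.glim ρ = ρ.im) ∧
      ∀ K : ℝ, ∀ k₀ : ℕ, ∃ k ≥ k₀, ∃ n ∈ Finset.Ico (S.N k) (2 * S.N k),
        lowSumRe S.glim n (S.Y k) < K - Real.log n / 2 := by
  obtain ⟨S, h1, h2, h3, h4, h5, h6, h7⟩ := theoremA_infty mseq hm (fun k ↦ -(k : ℝ))
  refine ⟨S, h1, h2, h3, h4, h5, h6, fun K k₀ ↦ ?_⟩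
  refine ⟨max k₀ ⌈-K⌉₊, le_max_left _ _, ?_⟩
  obtain ⟨n, hn, hlt⟩ := h7 (max k₀ ⌈-K⌉₊)
  refine ⟨n, hn, lt_of_lt_of_le hlt ?_⟩
  have : -K ≤ ((max k₀ ⌈-K⌉₊ : ℕ) : ℝ) := (Nat.le_ceil (-K)).trans (by exact_mod_cast le_max_right _ _)
  linarith

end Summit.RiemannHypothesis.RiemannHypothesis.Theorems.Splittings.LiRephasingScales
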